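import Summits.Ventures.LatticeQCDFlow.Exactness.IMHWeightLevelMasses
import Summits.Ventures.LatticeQCDFlow.Exactness.FlowAcceptanceOverlap
import HarnessLib

/-!
# The flow sampler accepts at least `κ/2`: per-state acceptance `≥ Z²/(W₂ + bZ)`, mean acceptance `≥ Z²/(2W₂)`

HONEST FRAMING: exact (Metropolis-corrected) sampling algorithms for lattice gauge theory;
figures of merit are autocorrelation/cost numbers at stated couplings and volumes; no
continuum-physics claim.  (SCALAR calibration rung S0-A: not a gauge result.)

Venture `LatticeQCDFlow` (cell pub-lqcd), topic `Exactness`; FANOUT row 2 (`s0-phi4`, FLOW arm).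
NEW WORK of the cell (two tangent-line Jensen steps over Mathlib), SHARPENING the acceptance
floor `ā ≥ (κ/(1+κ))²` of `IMHAcceptanceGeESS.lean` to the LINEAR `ā ≥ κ/2`.  Printed
counterpart NAMED ONLY (found in presearch; the Lean proof is the cell's): G. Deligiannidis and
A. Lee, *Which ergodic averages have finite asymptotic variance?*, Ann. Appl. Probab. 28 (2018),
§3 Lemma/Corollary — the per-state acceptance of the independence sampler is at least
`1/(π(w) + w(x))` [corpus: paper:arxiv-1606.08373 p.7]; the same paper characterises the IMH
ergodic averages of finite asymptotic variance (`f ∈ L²(π)`, `w f ∈ L²(q)`), of which the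
bounded-observable dichotomy of `IMHTauIntInfiniteOfWeightMoment.lean` is the special case
(independent proof there, via the cell's Smith–Tierney closed form).

## What is proved (`w, q > 0` measurable integrable, `∫ q = 1`, `Z = ∫ w`, `b = w/q`,
`W₂ = ∫ b w dμ < ∞`, `κ = Z²/W₂`, `λ = rejCurve`)

* `inv_ge_tangent` — `1/y ≥ 2/c − y/c²` (`y, c > 0`);
* `one_sub_rejCurve_eq_integral_inv_max` — `1 − λ(v) = ∫ w / max(b, v) dμ` (`v > 0`);
* **`one_sub_rejCurve_ge`** — `1 − λ(v) ≥ Z²/(W₂ + vZ)`: a state of weight `v` accepts at least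
  the fraction `1/(1/κ + v/Z)` of its proposals;
* **`meanAccept_ge_half_ESS`** — `∫ (1 − λ(b)) w dμ ≥ Z³/(2W₂)`, i.e. the equilibrium acceptance
  `ā = E_π[1 − λ(b)] ≥ Z²/(2W₂) = κ/2`;
* `meanAccept_overlapForm_ge_half_ESS` — the same in the `∫∫ min(p(x)q(y), p(y)q(x))` form of
  `FlowAcceptanceOverlap.lean` (`p = w/Z`); lattice **`phi4Flow_meanAccept_ge_half_ESS`**.

Reading for S0-A and the battery (no numerics implied): the consistency check between the
acceptance and ESS columns is `ā ≥ κ/2` up to statistical error (e.g. `κ̂ = 0.3` forces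
`ā ≥ 0.15`); `IMHAcceptanceGeESS` gave the weaker `(κ/(1+κ))²`.  NOT CLAIMED: an upper bound on
`ā` by `κ`; anything out of equilibrium; any number for a trained network.
-/

namespace Summit.Ventures.LatticeQCDFlow.Exactness

open Real MeasureTheory Filter Set Topology
open Summit.Ventures.LatticeQCDFlow.Scoring

/-- Tangent line of the convex function `1/y` at `c`: `1/y ≥ 2/c − y/c²` for `y, c > 0`. -/
theorem inv_ge_tangent {y c : ℝ} (hy : 0 < y) (hc : 0 < c) : 2 / c - y / c ^ 2 ≤ 1 / y := by
  rw [div_sub_div _ _ hc.ne' (pow_pos hc 2).ne', div_le_div_iff₀ (mul_pos hc (pow_pos hc 2)) hy]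
  nlinarith [sq_nonneg (y - c), mul_pos hc (pow_pos hc 2), mul_pos hy hc]

variable {X : Type*} [MeasurableSpace X] {μ : Measure X} {w q : X → ℝ}

variable [SFinite μ]

omit [SFinite μ] in
/-- **`1 − λ(v) = ∫ w/max(b, v) dμ`** (`v > 0`): the acceptance mass from a state of weight `v`,
written against the target weight (`min(1, b/v) q = w/max(b, v)`). -/
theorem one_sub_rejCurve_eq_integral_inv_max (hw0 : ∀ t, 0 < w t) (hwm : Measurable w)
    (hq0 : ∀ t, 0 < q t) (hqm : Measurable q) (hqi : Integrable q μ) (hq1 : ∫ z, q z ∂μ = 1)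
    {v : ℝ} (hv : 0 < v) :
    1 - rejCurve μ w q v = ∫ z, w z / max (w z / q z) v ∂μ := by
  have hint := integrable_rejCurve_integrand hw0 hwm hq0 hqm hqi hv
  have e : ∫ z, w z / max (w z / q z) v ∂μ
      = (∫ z, q z ∂μ) - ∫ z, (1 - min 1 (w z / q z / v)) * q z ∂μ := by
    rw [← integral_sub hqi hint]
    refine integral_congr_ae (Eventually.of_forall fun z => ?_)
    show w z / max (w z / q z) v = q z - (1 - min 1 (w z / q z / v)) * q z
    have hqz := hq0 z
    have hwz := hw0 z
    have hbz : 0 < w z / q z := div_pos hwz hqz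
    by_cases h : w z / q z ≤ v
    · rw [max_eq_right h, min_eq_right ((div_le_one hv).2 h)]
      field_simp
      ring
    · have h' : v < w z / q z := not_le.1 h
      rw [max_eq_left h'.le, min_eq_left ((one_le_div hv).2 h'.le)]
      field_simp
      ring
  unfold rejCurve
  rw [e, hq1]

omit [SFinite μ] in
/-- **PER-STATE ACCEPTANCE FLOOR `1 − λ(v) ≥ Z²/(W₂ + vZ)`** (`v > 0`, `W₂ = ∫ b w < ∞`):
`∫ w/max(b, v) ≥ Z²/∫ w max(b, v) ≥ Z²/(W₂ + vZ)` (Jensen for `1/y` under `w dμ/Z`). -/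
theorem one_sub_rejCurve_ge (hw0 : ∀ t, 0 < w t) (hwm : Measurable w) (hwi : Integrable w μ)
    (hq0 : ∀ t, 0 < q t) (hqm : Measurable q) (hqi : Integrable q μ) (hq1 : ∫ z, q z ∂μ = 1)
    (hW₂ : Integrable (fun x => w x / q x * w x) μ) {v : ℝ} (hv : 0 < v) :
    (∫ z, w z ∂μ) ^ 2 / ((∫ z, w z / q z * w z ∂μ) + v * ∫ z, w z ∂μ) ≤ 1 - rejCurve μ w q v := by
  set Z : ℝ := ∫ z, w z ∂μ with hZdef
  set W : ℝ := ∫ z, w z / q z * w z ∂μ with hWdef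
  have hZ : 0 < Z := integral_pos_of_pos hw0 hwi hq1
  have hW0 : 0 ≤ W := integral_nonneg fun z =>
    mul_nonneg (div_nonneg (hw0 z).le (hq0 z).le) (hw0 z).le
  -- tangent point `c = (W₂ + vZ)/Z`, the mean of `max(b, v)` under `w/Z` is at most `c`
  set c : ℝ := (W + v * Z) / Z with hcdef
  have hc : 0 < c := by positivity
  rw [one_sub_rejCurve_eq_integral_inv_max hw0 hwm hq0 hqm hqi hq1 hv]
  have hb0 : ∀ z, 0 < w z / q z := fun z => div_pos (hw0 z) (hq0 z)
  have hm0 : ∀ z, 0 < max (w z / q z) v := fun z => lt_max_of_lt_left (hb0 z)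
  have hbm : Measurable fun z => w z / q z := hwm.div hqm
  -- integrability
  have hI1 : Integrable (fun z => w z / max (w z / q z) v) μ := by
    refine Integrable.mono' (hwi.div_const v) ((hwm.div (hbm.max measurable_const)).aestronglyMeasurable)
      (Eventually.of_forall fun z => ?_)
    rw [Real.norm_eq_abs, abs_of_nonneg (div_nonneg (hw0 z).le (hm0 z).le)]
    exact div_le_div_of_nonneg_left (hw0 z).le hv (le_max_right _ _)
  have hI2 : Integrable (fun z => w z * max (w z / q z) v) μ := by
    refine Integrable.mono' (hW₂.add (hwi.const_mul v)) ((hwm.mul (hbm.max measurable_const)).aestronglyMeasurable)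
      (Eventually.of_forall fun z => ?_)
    rw [Real.norm_eq_abs, abs_of_nonneg (mul_nonneg (hw0 z).le (hm0 z).le)]
    show w z * max (w z / q z) v ≤ w z / q z * w z + v * w z
    rcases le_or_gt (w z / q z) v with h | h
    · rw [max_eq_right h]
      nlinarith [hw0 z, hb0 z]
    · rw [max_eq_left h.le]
      nlinarith [hw0 z, hv]
  -- tangent-line Jensen: `w/max ≥ w (2/c − max/c²)`
  have hpt : ∀ z, w z * (2 / c - max (w z / q z) v / c ^ 2) ≤ w z / max (w z / q z) v := fun z =>
    calc w z * (2 / c - max (w z / q z) v / c ^ 2) ≤ w z * (1 / max (w z / q z) v) :=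
          mul_le_mul_of_nonneg_left (inv_ge_tangent (hm0 z) hc) (hw0 z).le
      _ = w z / max (w z / q z) v := mul_one_div _ _
  have hlin : Integrable (fun z => w z * (2 / c - max (w z / q z) v / c ^ 2)) μ := by
    have e : (fun z => w z * (2 / c - max (w z / q z) v / c ^ 2))
        = fun z => (2 / c) * w z - (1 / c ^ 2) * (w z * max (w z / q z) v) := by
      funext z; ring
    rw [e]
    exact (hwi.const_mul _).sub (hI2.const_mul _)
  have hmax_le : ∫ z, w z * max (w z / q z) v ∂μ ≤ W + v * Z := by
    have e : W + v * Z = ∫ z, (w z / q z * w z + v * w z) ∂μ := by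
      rw [integral_add hW₂ (hwi.const_mul v), integral_const_mul]
    rw [e]
    refine integral_mono hI2 (hW₂.add (hwi.const_mul v)) fun z => ?_
    show w z * max (w z / q z) v ≤ w z / q z * w z + v * w z
    rcases le_or_gt (w z / q z) v with h | h
    · rw [max_eq_right h]
      nlinarith [hw0 z, hb0 z]
    · rw [max_eq_left h.le]
      nlinarith [hw0 z, hv]
  have hval : ∫ z, w z * (2 / c - max (w z / q z) v / c ^ 2) ∂μ
      = (2 / c) * Z - (1 / c ^ 2) * ∫ z, w z * max (w z / q z) v ∂μ := by
    have e : ∀ z, w z * (2 / c - max (w z / q z) v / c ^ 2)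
        = (2 / c) * w z - (1 / c ^ 2) * (w z * max (w z / q z) v) := fun z => by ring
    simp_rw [e]
    rw [integral_sub (hwi.const_mul _) (hI2.const_mul _), integral_const_mul, integral_const_mul]
  calc Z ^ 2 / (W + v * Z) = (2 / c) * Z - (1 / c ^ 2) * (W + v * Z) := by
        rw [hcdef]
        have hZne := hZ.ne'
        have hWZ : W + v * Z ≠ 0 := by positivity
        field_simp
        ring
    _ ≤ (2 / c) * Z - (1 / c ^ 2) * ∫ z, w z * max (w z / q z) v ∂μ := by
        have : 0 ≤ 1 / c ^ 2 := by positivity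
        nlinarith
    _ = ∫ z, w z * (2 / c - max (w z / q z) v / c ^ 2) ∂μ := hval.symm
    _ ≤ ∫ z, w z / max (w z / q z) v ∂μ := integral_mono hlin hI1 hpt

/-- **MEAN ACCEPTANCE `≥ κ/2`.**  `∫ (1 − λ(b)) w dμ ≥ Z³/(2W₂)`, i.e. the equilibrium acceptance
`ā = E_π[1 − λ(b)]` of the exact flow sampler is at least `Z²/(2W₂) = κ/2`
(`1 − λ(b) ≥ Z²/(W₂ + bZ)` and Jensen for `y ↦ 1/(W₂ + yZ)` under `π`). -/
theorem meanAccept_ge_half_ESS (hw0 : ∀ t, 0 < w t) (hwm : Measurable w) (hwi : Integrable w μ)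
    (hq0 : ∀ t, 0 < q t) (hqm : Measurable q) (hqi : Integrable q μ) (hq1 : ∫ z, q z ∂μ = 1)
    (hW₂ : Integrable (fun x => w x / q x * w x) μ) :
    (∫ z, w z ∂μ) ^ 3 / (2 * ∫ z, w z / q z * w z ∂μ)
      ≤ ∫ x, (1 - rejCurve μ w q (w x / q x)) * w x ∂μ := by
  set Z : ℝ := ∫ z, w z ∂μ with hZdef
  set W : ℝ := ∫ z, w z / q z * w z ∂μ with hWdef
  have hZ : 0 < Z := integral_pos_of_pos hw0 hwi hq1
  have hb0 : ∀ x, 0 < w x / q x := fun x => div_pos (hw0 x) (hq0 x)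
  have hW : 0 < W := integral_pos_of_pos (fun x => mul_pos (hb0 x) (hw0 x)) hW₂ hq1
  have hbm : Measurable fun x => w x / q x := hwm.div hqm
  -- the acceptance integrand is integrable and dominates `w Z²/(W + bZ)`
  have hlam01 : ∀ x, 0 ≤ 1 - rejCurve μ w q (w x / q x) ∧ 1 - rejCurve μ w q (w x / q x) ≤ 1 :=
    fun x => ⟨sub_nonneg.2 (rejCurve_lt_one hw0 hwm hq0 hqm hqi hq1 (hb0 x)).le,
      by linarith [(rejCurve_bounds hw0 hq0 hqi (hb0 x) (μ := μ)).1]⟩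
  have hIacc : Integrable (fun x => (1 - rejCurve μ w q (w x / q x)) * w x) μ := by
    refine Integrable.mono' hwi (((measurable_const.sub ((measurable_rejCurve hwm hqm).comp
      hbm)).mul hwm).aestronglyMeasurable) (Eventually.of_forall fun x => ?_)
    obtain ⟨h0, h1⟩ := hlam01 x
    rw [Real.norm_eq_abs, abs_of_nonneg (mul_nonneg h0 (hw0 x).le)]
    exact mul_le_of_le_one_left (hw0 x).le h1
  -- second tangent-line Jensen with `c' = 2W`: `Z²/(W + yZ) ≥ Z² (2/c' − (W + yZ)/c'²)`
  have hc' : 0 < 2 * W := by positivity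
  have hpt : ∀ x, w x * (Z ^ 2 * (2 / (2 * W) - (W + w x / q x * Z) / (2 * W) ^ 2))
      ≤ (1 - rejCurve μ w q (w x / q x)) * w x := fun x => by
    have hy : 0 < W + w x / q x * Z := add_pos_of_pos_of_nonneg hW (mul_nonneg (hb0 x).le hZ.le)
    have h1 := inv_ge_tangent hy hc'
    have h2 := one_sub_rejCurve_ge hw0 hwm hwi hq0 hqm hqi hq1 hW₂ (hb0 x)
    rw [← hZdef, ← hWdef] at h2
    rw [mul_comm ((1 : ℝ) - _)]
    refine mul_le_mul_of_nonneg_left (le_trans ?_ h2) (hw0 x).le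
    calc Z ^ 2 * (2 / (2 * W) - (W + w x / q x * Z) / (2 * W) ^ 2)
        ≤ Z ^ 2 * (1 / (W + w x / q x * Z)) := mul_le_mul_of_nonneg_left h1 (sq_nonneg _)
      _ = Z ^ 2 / (W + w x / q x * Z) := by rw [mul_one_div]
  have hlin : Integrable (fun x => w x * (Z ^ 2 * (2 / (2 * W) - (W + w x / q x * Z) / (2 * W) ^ 2))) μ := by
    have e : (fun x => w x * (Z ^ 2 * (2 / (2 * W) - (W + w x / q x * Z) / (2 * W) ^ 2)))
        = fun x => (Z ^ 2 * (2 / (2 * W) - W / (2 * W) ^ 2)) * w x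
          - (Z ^ 3 / (2 * W) ^ 2) * (w x / q x * w x) := by
      funext x; ring
    rw [e]
    exact (hwi.const_mul _).sub (hW₂.const_mul _)
  have hval : ∫ x, w x * (Z ^ 2 * (2 / (2 * W) - (W + w x / q x * Z) / (2 * W) ^ 2)) ∂μ
      = Z ^ 3 / (2 * W) := by
    have e : ∀ x, w x * (Z ^ 2 * (2 / (2 * W) - (W + w x / q x * Z) / (2 * W) ^ 2))
        = (Z ^ 2 * (2 / (2 * W) - W / (2 * W) ^ 2)) * w x
          - (Z ^ 3 / (2 * W) ^ 2) * (w x / q x * w x) := fun x => by ring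
    simp_rw [e]
    rw [integral_sub (hwi.const_mul _) (hW₂.const_mul _), integral_const_mul, integral_const_mul,
      ← hZdef, ← hWdef]
    have hWne := hW.ne'
    field_simp
    ring
  rw [← hval]
  exact integral_mono hlin hIacc hpt

/-- **`ā ≥ κ/2` in the overlap form** of `FlowAcceptanceOverlap.lean`: with `p = w/Z`,
`∫∫ min(p(x)q(y), p(y)q(x)) dμ dμ ≥ Z²/(2W₂)`. -/
theorem meanAccept_overlapForm_ge_half_ESS (hw0 : ∀ t, 0 < w t) (hwm : Measurable w)
    (hwi : Integrable w μ) (hq0 : ∀ t, 0 < q t) (hqm : Measurable q) (hqi : Integrable q μ)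
    (hq1 : ∫ z, q z ∂μ = 1) (hW₂ : Integrable (fun x => w x / q x * w x) μ) :
    (∫ z, w z ∂μ) ^ 2 / (2 * ∫ z, w z / q z * w z ∂μ)
      ≤ ∫ x, ∫ y, min (w x / (∫ z, w z ∂μ) * q y) (w y / (∫ z, w z ∂μ) * q x) ∂μ ∂μ := by
  set Z : ℝ := ∫ z, w z ∂μ with hZdef
  have hZ : 0 < Z := integral_pos_of_pos hw0 hwi hq1
  have hp0 : ∀ x, 0 < w x / Z := fun x => div_pos (hw0 x) hZ
  rw [meanAccept_eq hp0 hq0]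
  -- the inner acceptance mass is `1 − λ(b(x))` (the `Z`'s cancel)
  have hb0 : ∀ x, 0 < w x / q x := fun x => div_pos (hw0 x) (hq0 x)
  have hinner : ∀ x, ∫ y, min 1 (w y / Z * q x / (w x / Z * q y)) * q y ∂μ
      = 1 - rejCurve μ w q (w x / q x) := by
    intro x
    have hint := integrable_rejCurve_integrand hw0 hwm hq0 hqm hqi (hb0 x) (μ := μ)
    have e : ∀ y, min 1 (w y / Z * q x / (w x / Z * q y)) * q y
        = q y - (1 - min 1 (w y / q y / (w x / q x))) * q y := by
      intro y
      have hZne := hZ.ne'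
      have hqy := (hq0 y).ne'
      have hqx := (hq0 x).ne'
      have hwx := (hw0 x).ne'
      have e1 : w y / Z * q x / (w x / Z * q y) = w y / q y / (w x / q x) := by
        field_simp
      rw [e1]
      ring
    simp_rw [e]
    rw [integral_sub hqi hint, hq1]
    rfl
  simp_rw [hinner]
  have e2 : ∫ x, (1 - rejCurve μ w q (w x / q x)) * (w x / Z) ∂μ
      = (∫ x, (1 - rejCurve μ w q (w x / q x)) * w x ∂μ) / Z := by
    rw [← integral_div]
    refine integral_congr_ae (Eventually.of_forall fun x => ?_)
    show (1 - rejCurve μ w q (w x / q x)) * (w x / Z) = (1 - rejCurve μ w q (w x / q x)) * w x / Z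
    ring
  rw [e2, le_div_iff₀ hZ]
  have h := meanAccept_ge_half_ESS hw0 hwm hwi hq0 hqm hqi hq1 hW₂
  rw [← hZdef] at h
  have hW : 0 < ∫ z, w z / q z * w z ∂μ :=
    integral_pos_of_pos (fun x => mul_pos (hb0 x) (hw0 x)) hW₂ hq1
  calc Z ^ 2 / (2 * ∫ z, w z / q z * w z ∂μ) * Z = Z ^ 3 / (2 * ∫ z, w z / q z * w z ∂μ) := by
        field_simp
    _ ≤ ∫ x, (1 - rejCurve μ w q (w x / q x)) * w x ∂μ := h

/-! ## The lattice: row 2's φ⁴ flow sampler -/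

section Lattice

variable {n : ℕ}

/-- **`ā ≥ κ/2` FOR THE φ⁴ FLOW SAMPLER**: every `λ > 0`, real `J`, positive measurable model
density `q̃` with `∫ q̃ = 1` and `W₂ = ∫ (e^{−S}/q̃) e^{−S} < ∞`; with `p = e^{−S}/Z`:
`∫∫ min(p(φ)q̃(φ'), p(φ')q̃(φ)) ≥ Z²/(2W₂)`. -/
theorem phi4Flow_meanAccept_ge_half_ESS {lam : ℝ} (hlam : 0 < lam)
    (J : Fin (n + 1) → Fin (n + 1) → ℝ) {q : (Fin (n + 1) → ℝ) → ℝ} (hq0 : ∀ φ, 0 < q φ)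
    (hqm : Measurable q) (hqi : Integrable q) (hq1 : ∫ φ, q φ = 1)
    (hW₂ : Integrable (fun φ => gibbsWeight J lam φ / q φ * gibbsWeight J lam φ)) :
    (∫ φ, gibbsWeight J lam φ) ^ 2 / (2 * ∫ φ, gibbsWeight J lam φ / q φ * gibbsWeight J lam φ)
      ≤ ∫ φ, ∫ φ', min (gibbsWeight J lam φ / (∫ ψ, gibbsWeight J lam ψ) * q φ')
          (gibbsWeight J lam φ' / (∫ ψ, gibbsWeight J lam ψ) * q φ) :=
  meanAccept_overlapForm_ge_half_ESS (μ := volume) (fun ψ => gibbsWeight_pos J lam ψ)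
    (continuous_gibbsWeight J lam).measurable (integrable_gibbsWeight hlam J) hq0 hqm hqi hq1 hW₂

end Lattice

end Summit.Ventures.LatticeQCDFlow.Exactness
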